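import Summits.BirchSwinnertonDyer.BirchSwinnertonDyer.Theorems.SignedLowerHalvesSmallImageLowerHalfBothSignsRttFloorCert
import Summits.BirchSwinnertonDyer.BirchSwinnertonDyer.Theorems.SignedLowerHalvesKobayashiLowerHalfLargeImageCongruenceShapeBound
import Summits.BirchSwinnertonDyer.BirchSwinnertonDyer.Theorems.SignedLowerHalvesKobayashiMainConjectureSmallImageCMTransferRecordsE
import HarnessLib

/-!
# Route `SignedLowerHalves`, crux L `SmallImageLowerHalfBothSigns` (item stmt-BirchSwinnertonDyer-23599), line `rtt_w3` v5:
# the SELF-RANK SQUEEZE — crux L's body (indeed Kobayashi's main conjecture at the certified sign) at a small-image pair whose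
# displayed analytic `λ` at ONE sign is at most its Mordell–Weil rank: NO partner, NO transport, NO `μ(X^ε) = 0` hypothesis

Width seat `bsd-line-slh-p3-w3` g14 under LEAD `cruxlead-stmt-BirchSwinnertonDyer-23599` g3 (cell `bsd-ssimc`); ROUTE-INDEPENDENT
helper (`--supports stmt-BirchSwinnertonDyer-23599`); THEOREMS ONLY — no definition, no named fact, no `sorry`; PER PAIR machinery;
closes nothing class-wide; BSD / crux L are NOT proved by this.

WHAT. The LEAD's one-sided core `kobayashiMainConjecture_of_lamTransport_le` (file `…RttOneSidedCore`, p741163) turns, at a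
small-image pair (`p` odd, good, `a_p = 0`, `ρ̄` NOT onto), the floor `μ(L^ε_p) = 0` plus ANY lower bound `λ(L^ε_p) ≤ λ(X^ε)` into
Kobayashi's main conjecture at the sign `ε` (Kato's RATIONAL divisibility `h41` gives the other inequality; the small-image
`μ`-control brick `SmallImageMuControl.mu_eq_zero_…` gives `μ(X^ε) = 0` from the floor, modulo the Coleman–Kato package `hJ`). Line
`rtt_w3` feeds the lower bound by TRANSPORT from a partner. This file feeds it by the pair's OWN RANK: the large-image cell's
`CongruenceRoad.le_lambdaInvariant_of_le_mordellWeilRank` (Kummer points in `Sel^ε` over `ℚ`: `T^{rank E(ℚ)} ∣ char X^ε(E)`, hence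
`rank E(ℚ) ≤ λ(X^ε)`, image-free, no certificate) — so a displayed Mazur–Tate row `(μ, λ)(L^ε_p(E)) = (0, l)` with `l ≤ rank E(ℚ)`
closes the pair. Compared with k3-c4's rank-one squeeze for the parent crux
(`kobayashiMainConjecture_of_mu_eq_zero_of_cert_of_analyticRank_eq_one`, file `…SmallImageMuSaturationRankOne`), the hypothesis
`μ(X^ε) = 0` (there supplied by a CM partner) is GONE, any rank `≥ l` is allowed, and no partner / congruence / Fisher fact /
Pollack–Rubin / B. D. Kim / Vatsal / Hida–Carayol–Saito enters: the print inputs are `hJ h12 h41 h5 h3` only (+ `hGZK` when the rank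
is read off `r_an = 1`). Targets: every small-image pair of rank `r ≥ 1` whose `λ^ε = r` at one sign — e.g. `50112bq1 @ 5` (`r_an = 1`,
`λ(θ_3^−) = 20 + 1`, disprover kit j335262) recorded in §3, and the two rank-1 tier-T2 pairs at `p = 3` (`314678ca1`, `380894f1`) as soon
as one Mazur–Tate row of theirs is displayed (no engine has tabulated them yet).

* §1 ★ `kobayashiMainConjecture_of_selfRank_of_mazurTateRow` (MC at the row's sign) and
  ★ `forall_kobayashiLowerDivisibility_of_selfRank_of_mazurTateRow` (crux L's body, both signs, X7 pairs, via Kobayashi (7.21) `hJ`).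
* §2 the `r_an = 1` forms (`…_of_analyticRank_eq_one`, GZK `hGZK` by name, `l ≤ 1`).
* §3 record `forall_kobayashiLowerDivisibility_c50112bq1_5_of_selfRank` — `50112bq1 @ 5` from `hJ h12 h41 h5 h3 hGZK` + displayed
  `r_an = 1` + ONE displayed odd row; versus its tier-T1 records (LEAD p749857: 12 facts + `hF'` + `hfloor`; this seat's
  `…FloorCertRecords04`: 12 facts + `hF'` + row) the CM partner and seven named facts leave.

References: [Kobayashi2003] Conjecture (p. 2), Thm. 1.2, Thm. 4.1, Thm. 7.4; [GreenbergLNM1716] §3 Lemma 3.1; [Pollack2003]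
Prop. 6.9, 6.10, 6.18, Cor. 5.11; [GreenbergVatsal2000] p. 4, §3 Rem. 3.4; [Cremona2006] Table 1 (label 50112bq1).
-/

set_option autoImplicit false
-- D-0017: single-problem summit, the namespace repeats the problem name by design.
set_option linter.dupNamespace false
noncomputable section

open scoped Classical MatrixGroups ModularForm BigOperators

open CongruenceSubgroup WeierstrassCurve Field Polynomial NumberField IsDedekindDomain
  Literature.NumberTheory.EllipticCurves Literature.NumberTheory.EllipticCurves.ModularForms
  Literature.NumberTheory.EllipticCurves.Rank1Residual
  Literature.NumberTheory.EllipticCurves.Rank1Residual.Typed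
  Literature.NumberTheory.EllipticCurves.Rank1Residual.X11RankOneCertificates
  Literature.NumberTheory.EllipticCurves.Kobayashi2003
  Literature.NumberTheory.EllipticCurves.GreenbergVatsal2000 ZpExtension
  Literature.NumberTheory.IwasawaTheory Rat.HeightOneSpectrum
  Summit.BirchSwinnertonDyer.Rank1Residual.Supersingular
  Summit.BirchSwinnertonDyer.Rank1Residual.X1.MuLambda
  Summit.BirchSwinnertonDyer.BirchSwinnertonDyer.Rank1Residual.IntModel
  Summit.BirchSwinnertonDyer.BirchSwinnertonDyer.Rank1Residual.X11RankOne
  Summit.BirchSwinnertonDyer.Rank1Residual.X11b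
  Summit.BirchSwinnertonDyer.Rank1Residual.X9
  Summit.BirchSwinnertonDyer.Rank1Residual.X1
  Summit.BirchSwinnertonDyer.BirchSwinnertonDyer.Theorems.SmallImageLambdaLowerThreeNsThetaTransport

namespace Summit.BirchSwinnertonDyer.BirchSwinnertonDyer.Theorems.SmallImageRttOneSided

/-! ## §1 The self-rank squeeze -/

section SelfRank

variable (W : WeierstrassCurve ℚ) [W.IsElliptic] [W.IsGloballyMinimal] (p : ℕ) [Fact p.Prime]

/-- ★ **Kobayashi's main conjecture at ONE sign from the pair's OWN RANK and ONE Mazur–Tate row — small image, odd `p`, NO partner.**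
`W/ℚ` good at the odd `p` with `a_p = 0` and `ρ̄_{W,p}` NOT onto; a displayed row at a layer `n` of the parity of `ε₀`: for every newform
`f` of `W`, `θ_n(f) = Θ ∈ Λ`, `Θ ≠ 0`, `μ(Θ) = 0`, `λ(Θ) = deg ω_n^{−ε₀} + l` (so `(μ, λ)(L^{ε₀}_p) = (0, l)` by the b2b certificate theorems);
and `l ≤ rank W(ℚ)`. GRANTED BY NAME the Coleman–Kato package (`hJ`), Kobayashi Thm 1.2 (`h12`), Thm 4.1 rational (`h41`), the period
units (`h5 h3`): `KobayashiMainConjecture W p ε₀`. Chain: the row is the floor (`hasUnitContent_kobayashiL_of_mazurTateRow`) and pins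
`λ(G) = λ(L^{ε₀}) = l` for every `G` with `ι G = C(p^m ϖ)·ι L^{ε₀}` (`ResidualThetaLayer.lam_eq_of_iwasawaToPowerSeries_eq_C_mul`);
`l ≤ rank ≤ λ(X^{ε₀})` by `CongruenceRoad.le_lambdaInvariant_of_le_mordellWeilRank`; the one-sided core (p741163) concludes. Per pair;
CONDITIONAL on print and the displayed data; closes nothing class-wide.
[cite: Kobayashi2003, Conjecture (p. 2), Thm. 1.2, Thm. 4.1 (p. 8)] [cite: GreenbergLNM1716, §3 Lemma 3.1]
[cite: Pollack2003, Prop. 6.9, Prop. 6.10, Prop. 6.18 and Cor. 5.11] -/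
theorem kobayashiMainConjecture_of_selfRank_of_mazurTateRow
    (hJ : thm62_63_73_signedColemanKato_zetaJoint) (h12 : thm12_signedSelmerDual_finite_torsion)
    (h41 : thm41_signedCharIdeal_divisibility)
    (h5 : realPeriodRat_eq_unit_mul_plusPeriod) (h3 : realPeriodRat_eq_unit_mul_plusPeriod_three)
    (hp : p ≠ 2) (hgood : W.HasGoodReductionAtPrime p) (hap : W.frobeniusTrace p = 0) (hs : ¬ Surj W p)
    (ε₀ : ℤˣ) {n : ℕ} (hn : Even n ↔ ε₀ = 1) {l : ℕ}
    (hrow : ∀ [NeZero (W.conductorNorm ℤ)] (f : CuspForm (Gamma0 (W.conductorNorm ℤ)) 2), IsNewformOf W f →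
      ∃ Θ : IwasawaAlgebra p, iwasawaToPowerSeries p Θ =
          ((mazurTateElement f p n).map (algebraMap ℚ ℚ_[p]) : PowerSeries ℚ_[p]) ∧
        Θ ≠ 0 ∧ mu Θ = 0 ∧ lam Θ = (if ε₀ = 1 then cyclotomicOmegaMinus p n else cyclotomicOmegaPlus p n).natDegree + l)
    (hr : l ≤ W.mordellWeilRank) :
    KobayashiMainConjecture W p ε₀ := by
  refine kobayashiMainConjecture_of_lamTransport_le W p hp (thm62_63_73_signedColemanKato_zeta_of_joint hJ) h12 h41 h5 h3
    hgood hap hs ε₀ ?_ ?_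
  · intro _ f hf Lplus Lminus hPP
    obtain ⟨Θ, hΘ, hΘ0, hμ, hlam⟩ := hrow f hf
    exact hasUnitContent_kobayashiL_of_mazurTateRow hp hf hgood hap ε₀ hn hΘ hΘ0 hμ hlam hPP
  · intro κ γ hκ hγ hγ' _ f hf ϖ hϖ Lplus Lminus hPP D _ hXt _ G m hG
    obtain ⟨Θ, hΘ, hΘ0, hμ, hlam⟩ := hrow f hf
    have hl : lam (kobayashiL ε₀ Lplus Lminus) = l :=
      (mu_lam_kobayashiL_of_mazurTateRow hp hf hgood hap ε₀ hn hΘ hΘ0 hμ hlam hPP).2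
    have hL0 : kobayashiL ε₀ Lplus Lminus ≠ 0 := LargeImageLambdaTwoStratum.kobayashiL_ne_zero p hPP ε₀
    have hϖ0 : (ϖ : ℚ_[p]) ≠ 0 := by
      exact_mod_cast Summit.BirchSwinnertonDyer.Rank1Residual.X2.varpi_ne_zero_of_isNewformOf hf hϖ
    have hx0 : (p : ℚ_[p]) ^ m * (ϖ : ℚ_[p]) ≠ 0 :=
      mul_ne_zero (pow_ne_zero _ (by exact_mod_cast (Fact.out : p.Prime).ne_zero)) hϖ0
    have hlamG : lam G = lam (kobayashiL ε₀ Lplus Lminus) :=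
      (Summit.BirchSwinnertonDyer.BirchSwinnertonDyer.Theorems.ResidualThetaLayer.lam_eq_of_iwasawaToPowerSeries_eq_C_mul
        hx0 hL0 hG).2
    rw [hlamG, hl]
    exact CongruenceRoad.le_lambdaInvariant_of_le_mordellWeilRank (p := p) ε₀ hr κ γ hκ hγ hγ' D hXt

/-- ★ **Crux L's body `∀ ε, KobayashiLowerDivisibility W p ε` at a small-image supersingular X7 pair from the pair's OWN RANK and ONE
Mazur–Tate row — NO partner.** (`p` odd, `ClassX7 W p`, `a_p = 0`, `¬ Surj W p`; the row at one sign `ε₀` as in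
`kobayashiMainConjecture_of_selfRank_of_mazurTateRow`, `l ≤ rank W(ℚ)`.) The main conjecture at `ε₀` gives the lower divisibility
there, and Kobayashi's (7.21) equivalence (`SignDefect.X7.exists_kobayashiLowerDivisibility_iff_forall`, `hJ`) gives the other sign.
Print inputs: `hJ h12 h41 h5 h3` ONLY. Per pair; CONDITIONAL; closes nothing class-wide.
[cite: Kobayashi2003, Conjecture (p. 2), Thm. 7.4 (p. 13)] [cite: GreenbergLNM1716, §3 Lemma 3.1] [cite: Pollack2003, Prop. 6.18] -/
theorem forall_kobayashiLowerDivisibility_of_selfRank_of_mazurTateRow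
    (hJ : thm62_63_73_signedColemanKato_zetaJoint) (h12 : thm12_signedSelmerDual_finite_torsion)
    (h41 : thm41_signedCharIdeal_divisibility)
    (h5 : realPeriodRat_eq_unit_mul_plusPeriod) (h3 : realPeriodRat_eq_unit_mul_plusPeriod_three)
    (hp : p ≠ 2) (hX : ClassX7 W p) (hap : W.frobeniusTrace p = 0) (hs : ¬ Surj W p)
    (ε₀ : ℤˣ) {n : ℕ} (hn : Even n ↔ ε₀ = 1) {l : ℕ}
    (hrow : ∀ [NeZero (W.conductorNorm ℤ)] (f : CuspForm (Gamma0 (W.conductorNorm ℤ)) 2), IsNewformOf W f →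
      ∃ Θ : IwasawaAlgebra p, iwasawaToPowerSeries p Θ =
          ((mazurTateElement f p n).map (algebraMap ℚ ℚ_[p]) : PowerSeries ℚ_[p]) ∧
        Θ ≠ 0 ∧ mu Θ = 0 ∧ lam Θ = (if ε₀ = 1 then cyclotomicOmegaMinus p n else cyclotomicOmegaPlus p n).natDegree + l)
    (hr : l ≤ W.mordellWeilRank) :
    ∀ ε : ℤˣ, KobayashiLowerDivisibility W p ε :=
  fun ε ↦ (SignDefect.X7.exists_kobayashiLowerDivisibility_iff_forall W p h12 h5 h3 hJ hp hX hap).mp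
    ⟨ε₀, kobayashiLowerDivisibility_of_mainConjecture
      (kobayashiMainConjecture_of_selfRank_of_mazurTateRow W p hJ h12 h41 h5 h3 hp hX.1.1 hap hs ε₀ hn hrow hr)⟩ ε

/-! ## §2 The analytic-rank-one forms (GZK by name) -/

/-- **Crux L's body at a small-image X7 pair of ANALYTIC RANK ONE from ONE Mazur–Tate row with `λ = deg ω_n^∓ + l`, `l ≤ 1`**
(Gross–Zagier–Kolyvagin `hGZK` BY NAME turns the displayed `r_an = 1` into `rank W(ℚ) = 1`). Print inputs `hJ h12 h41 h5 h3 hGZK`;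
NO partner. Per pair; CONDITIONAL; closes nothing class-wide. [cite: Kobayashi2003, Conjecture (p. 2), Thm. 7.4 (p. 13)]
[cite: GreenbergLNM1716, §3 Lemma 3.1] [cite: Pollack2003, Prop. 6.18] -/
theorem forall_kobayashiLowerDivisibility_of_analyticRank_eq_one_of_mazurTateRow
    (hJ : thm62_63_73_signedColemanKato_zetaJoint) (h12 : thm12_signedSelmerDual_finite_torsion)
    (h41 : thm41_signedCharIdeal_divisibility)
    (h5 : realPeriodRat_eq_unit_mul_plusPeriod) (h3 : realPeriodRat_eq_unit_mul_plusPeriod_three)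
    (hGZK : rank_eq_analyticRank_of_analyticRank_le_one)
    (hp : p ≠ 2) (hX : ClassX7 W p) (hap : W.frobeniusTrace p = 0) (hs : ¬ Surj W p)
    (ε₀ : ℤˣ) {n : ℕ} (hn : Even n ↔ ε₀ = 1) {l : ℕ}
    (hrow : ∀ [NeZero (W.conductorNorm ℤ)] (f : CuspForm (Gamma0 (W.conductorNorm ℤ)) 2), IsNewformOf W f →
      ∃ Θ : IwasawaAlgebra p, iwasawaToPowerSeries p Θ =
          ((mazurTateElement f p n).map (algebraMap ℚ ℚ_[p]) : PowerSeries ℚ_[p]) ∧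
        Θ ≠ 0 ∧ mu Θ = 0 ∧ lam Θ = (if ε₀ = 1 then cyclotomicOmegaMinus p n else cyclotomicOmegaPlus p n).natDegree + l)
    (hl : l ≤ 1) (h1 : W.analyticRank = 1) :
    ∀ ε : ℤˣ, KobayashiLowerDivisibility W p ε :=
  forall_kobayashiLowerDivisibility_of_selfRank_of_mazurTateRow W p hJ h12 h41 h5 h3 hp hX hap hs ε₀ hn hrow
    (hl.trans (le_of_eq ((hGZK W (by omega)).1.trans h1).symm))

end SelfRank

/-! ## §3 Record: `50112bq1 @ 5` by the self-rank squeeze -/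

section Record

/-- **Crux L's body at `50112bq1 @ 5` by the SELF-RANK SQUEEZE — NO partner** (Cremona model `[0, 0, 0, -12540, 321104]`, `N = 50112 = 2⁶·3³·29`,
X7 (additive at `3`), `a_5 = 0`, mod-5 image `5Nn`, analytic rank `1`): `∀ ε, KobayashiLowerDivisibility W 5 ε` from Kobayashi's
`hJ h12 h41`, the period units `h5 h3`, GZK `hGZK` (BY NAME), the displayed `r_an = 1` (Cremona) and ONE displayed odd Mazur–Tate
row: at `n = 3` (`deg ω_3^+ = deg Φ_25(1+T) = 20`), `θ_3(f) = Θ ∈ Λ`, `Θ ≠ 0`, `μ(Θ) = 0`, `λ(Θ) = 20 + 1` (disprover kit j335262,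
`gvkan2/LAYERS.tsv` row `50112bq1@5, n=4 (Pollack index 3), odd: μ = 0, λ = 21`; lower rows: index 1 (odd) `μ = 0, λ = 1`, index 2 (even)
`μ = 0, λ = 5 = 4 + 1`; engine B, ONE engine at `p = 5`; evidence #53–#56 on the item) ⇒ `(μ, λ)(L^−_5) = (0, 1) ≤ rank`.
`¬ Surj W 5` enters as the hypothesis `hs` (the pair's tier-T1 records derive it in the kernel from the CM partner `y² = x³ − 32` via
Zywina + the Hesse certificate; this record deliberately uses no partner, and the tree has no partner-free `5Nn` image certificate). Kernel-decided: `5 ∤ Δ`,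
`#Ẽ(𝔽₅) = 6` (k3-c4's `card_c50112bq1_5`), additive at `3`. Per pair; CONDITIONAL; nothing booked.
[cite: Kobayashi2003, Conjecture (p. 2), Thm. 7.4 (p. 13)] [cite: GreenbergLNM1716, §3 Lemma 3.1] [cite: Pollack2003, Prop. 6.18]
[cite: Cremona2006, Table 1 (Cremona label 50112bq1)] -/
theorem forall_kobayashiLowerDivisibility_c50112bq1_5_of_selfRank
    (hJ : thm62_63_73_signedColemanKato_zetaJoint) (h12 : thm12_signedSelmerDual_finite_torsion)
    (h41 : thm41_signedCharIdeal_divisibility)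
    (h5 : realPeriodRat_eq_unit_mul_plusPeriod) (h3 : realPeriodRat_eq_unit_mul_plusPeriod_three)
    (hGZK : rank_eq_analyticRank_of_analyticRank_le_one)
    (W : WeierstrassCurve ℚ) [W.IsElliptic] [W.IsGloballyMinimal] [Fact (Nat.Prime 5)] (hW : W = ⟨0, 0, 0, -12540, 321104⟩)
    (hs : ¬ Surj W 5) (hr : W.analyticRank = 1)
    (hrow : ∀ [NeZero (W.conductorNorm ℤ)] (f : CuspForm (Gamma0 (W.conductorNorm ℤ)) 2), IsNewformOf W f →
      ∃ Θ : IwasawaAlgebra 5, iwasawaToPowerSeries 5 Θ =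
          ((mazurTateElement f 5 3).map (algebraMap ℚ ℚ_[5]) : PowerSeries ℚ_[5]) ∧
        Θ ≠ 0 ∧ mu Θ = 0 ∧ lam Θ = (cyclotomicOmegaPlus 5 3).natDegree + 1) :
    ∀ ε : ℤˣ, KobayashiLowerDivisibility W 5 ε := by
  have hIW : integralModelInt W = ⟨0, 0, 0, -12540, 321104⟩ :=
    integralModelInt_eq_of_map_eq _ (by rw [hW]; ext <;> simp [WeierstrassCurve.map])
  have hΔ : (⟨0, 0, 0, -12540, 321104⟩ : WeierstrassCurve ℤ).Δ = discOf [0, 0, 0, -12540, 321104] :=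
    intCurve_Δ 0 0 0 (-12540) 321104
  have hc₄ : (⟨0, 0, 0, -12540, 321104⟩ : WeierstrassCurve ℤ).c₄ = c4Of [0, 0, 0, -12540, 321104] :=
    intCurve_c₄ 0 0 0 (-12540) 321104
  have hgood : W.HasGoodReductionAtPrime 5 :=
    hasGoodReductionAtPrime_of_not_dvd W 5 (by rw [minimalDiscriminantInt_eq hIW, hΔ]; decide +kernel)
  have hap : W.frobeniusTrace 5 = 0 := by rw [frobeniusTrace_eq hIW card_c50112bq1_5]; norm_num
  have hX : ClassX7 W 5 :=
    ⟨⟨hgood, by rw [hap]; exact dvd_zero _⟩, not_semistable_of_intModel hIW 3 (by norm_num) (by rw [hΔ]; decide +kernel)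
      (by rw [hc₄]; decide +kernel)⟩
  have hne : (-1 : ℤˣ) ≠ 1 := by decide
  refine forall_kobayashiLowerDivisibility_of_analyticRank_eq_one_of_mazurTateRow W 5 hJ h12 h41 h5 h3 hGZK (by norm_num) hX hap hs
    (-1) (n := 3) ⟨fun h ↦ absurd h (by decide), fun h ↦ absurd h hne⟩ (l := 1) ?_ le_rfl hr
  intro _ f hf
  obtain ⟨Θ, hΘ, hΘ0, hμ, hlam⟩ := hrow f hf
  exact ⟨Θ, hΘ, hΘ0, hμ, by rwa [if_neg hne]⟩

end Record

end Summit.BirchSwinnertonDyer.BirchSwinnertonDyer.Theorems.SmallImageRttOneSided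

end
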